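import Summits.AtomisticToContinuum.HydrodynamicLimit.Theorems.OneFlightGossipEngineClampedTransferDockCubicChannelRateBand
import HarnessLib

/-!
# The cubic channel paid by the tail alone, and the rate bookkeeping (registered sub-goal `tailRate_cubicTailWindow`,
# stub `stub_tailRateWindowClause`, line `tail-rate`, crux `TwoClocks.TransferEntropyClock`, stmt-AtomisticToContinuum-16625)

Helper file 3/4 (`--supports stmt-AtomisticToContinuum-16625`) of the stub `stub_tailRateWindowClause : TailRateWindowClause`.
With the kinetic cut-off `G_{K₁}` taken at the TAIL level there is NO band and NO coherence input in the cubic (heat-flux remainder)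
channel of Yau's one-window ledger: the remainder `(b·w)(‖w‖² − 5θ − G_{K₁}(x,‖w‖²))` is, pointwise, at most
`8Bb(1 + 5θM + Cr)‖v‖³1{‖v‖ > K₁ − U} + Bb K₁ Cr` (`hi_pointwise`; `Cr = Cρ e^{-c′K₁}` the bulk correction of the quantitative cut-off
of helper file 1/4), so the window channel under the TRUE law is `≤ w(N+1)(8Bb(1+5θM+Cr) eT + Bb K₁ Cr)` from per-time cubic tails
`≤ eT` (pathwise on the good set, then Tonelli — the landed `ClampedCurrentsDockCubicChannelPrelim.cubicTailWindow`); the tails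
themselves come from the Gaussian velocity moments (item stmt-14415) through the landed
`ClampedTransferDockSeet.lintegral_cubicTail_le_of_expMoment` in file 4/4. §3 is the pure real arithmetic of the rate: tilt
`β = min(κ/(Cg K₁), β₀C)`, tail rate `c′ = 10tCg/κ + 2`, floor `S = C_T e^{-c′(K₁−U)} + Bb K₁ Cρ e^{-c′K₁}` with `S e^{10t/β} ≤ A′e^{-K₁}`,
budget `4(1+t)(δe^{-2Kt}/(8(1+t)) + S)e^{2Kt} ≤ δ`, one ledger step. prover-line-stmt-AtomisticToContinuum-16625-c5-0.
-/

noncomputable section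

open MeasureTheory Filter Set Topology InformationTheory
open scoped ENNReal

namespace Summit.AtomisticToContinuum.HydrodynamicLimit.Theorems.TransferEntropyClockTailRateCubic

open Literature.MathematicalPhysics.KineticTheory Literature.Analysis.FluidPDE Literature.Analysis.FunctionSpaces

/-! ## §1 The statement -/

open Summit.AtomisticToContinuum.HydrodynamicLimit.Theorems.ClampedCurrentsDockCubicChannelPrelim
  (bfield slab_package cubicTailWindow tailSum tailSum_nonneg_le integrableOn_tailSum tendsto_window_zero)
open Summit.AtomisticToContinuum.HydrodynamicLimit.Theorems.EntropyClockDock (ae_mem_good_localGibbsLaw)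

/-- registered sub-goal signature `tailRate_cubicTailWindow` of line tail-rate, crux TransferEntropyClock (stmt-AtomisticToContinuum-16625):
**the cubic channel of one window under the TRUE law, paid by the velocity tail alone** — with a cut-off whose remainder is `≤ Cr`
below `K²` and `≤ |s′ − 5θ| + Cr` above, and per-time cubic tails `≤ eT` above `K − U` on `[s, s+w]`:
`E_λ|∫_s^{s+w} Σ_i hi_s(Φ_r z_i) dr| ≤ w(N+1)(8Bb(1 + 5θM + Cr) eT + Bb K Cr)` — route-internal, not a cited fact -/
def CubicTailWindowRate : Prop :=
  ∀ {σ : ℝ} {N : ℕ} (Φ : HardSphereFlow (Torus.geometry (Fin 3)) (hsDiameter σ N) (N + 1))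
    {a₀ θ₀ : T3 → ℝ} {u₀ : T3 → V3} {θ : ℝ → T3 → ℝ} {u : ℝ → T3 → V3} {G : ℝ → T3 × ℝ → ℝ}
    {K U Bb θM Cr eT s w : ℝ}
    (hσ : 0 < σ) (hσ2 : σ < 1 / 2) (ha : Continuous a₀) (hθ : Continuous θ₀) (hu : Continuous u₀)
    (ha0 : ∀ x, 0 < a₀ x) (hθ0 : ∀ x, 0 < θ₀ x)
    (hK1 : 1 ≤ K) (hKU : 2 * U ≤ K) (hBb : 0 ≤ Bb) (hθM0 : 0 ≤ θM) (hCr : 0 ≤ Cr) (heT : 0 ≤ eT) (hw : 0 ≤ w)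
    (hule : ∀ x, ‖u s x‖ ≤ U)
    (hble : ∀ x, ‖(WithLp.toLp 2 fun k => Torus.partialDeriv k (θ s) x / (2 * (θ s x) ^ 2) : V3)‖ ≤ Bb)
    (hθle : ∀ x, θ s x ≤ θM) (hθs0 : ∀ x, 0 ≤ θ s x)
    (hR1 : ∀ (x : T3) (s' : ℝ), 0 ≤ s' → s' ≤ K ^ 2 → |s' - 5 * θ s x - G s (x, s')| ≤ Cr)
    (hR2 : ∀ (x : T3) (s' : ℝ), K ^ 2 < s' → |s' - 5 * θ s x - G s (x, s')| ≤ |s' - 5 * θ s x| + Cr)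
    (hT : ∀ r ∈ Icc s (s + w), ∫⁻ z, ENNReal.ofReal (((N : ℝ) + 1)⁻¹ * ∑ i : Fin (N + 1),
        Set.indicator {v : V3 | K - U < ‖v‖} (fun v => ‖v‖ ^ 3) ((Φ.flow r z i).2)) ∂(localGibbsLaw σ a₀ u₀ θ₀ N Φ) ≤
        ENNReal.ofReal eT),
    ∫⁻ z, ENNReal.ofReal |∫ r in s..(s + w), ∑ i : Fin (N + 1),
        ((∑ k : Fin 3, Torus.partialDeriv k (θ s) (Φ.flow r z i).1 / (2 * (θ s (Φ.flow r z i).1) ^ (2 : ℕ)) *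
            ((Φ.flow r z i).2 - u s (Φ.flow r z i).1) k) *
          (‖(Φ.flow r z i).2 - u s (Φ.flow r z i).1‖ ^ (2 : ℕ) - 5 * θ s (Φ.flow r z i).1 -
            G s ((Φ.flow r z i).1, ‖(Φ.flow r z i).2 - u s (Φ.flow r z i).1‖ ^ (2 : ℕ))))|
        ∂(localGibbsLaw σ a₀ u₀ θ₀ N Φ) ≤
      ENNReal.ofReal (w * ((N : ℝ) + 1) * (8 * Bb * (1 + 5 * θM + Cr) * eT + Bb * K * Cr))

/-! ## §2 Pointwise and one window -/

/-- The peculiar cube above a level `K ≥ 2U` is at most `8` absolute cubes above `K − U` (`‖a‖ ≤ U`). [folklore] -/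
theorem cube_le_eight_indicator {v a : V3} {U K : ℝ} (ha : ‖a‖ ≤ U) (hK : 2 * U ≤ K) (hv : K < ‖v - a‖) :
    ‖v - a‖ ^ 3 ≤ 8 * Set.indicator {w : V3 | K - U < ‖w‖} (fun w => ‖w‖ ^ 3) v := by
  -- adapted from `ClampedTransferDockCubicRate.hiCube_le_band_add_top`
  have hva : ‖v - a‖ ≤ ‖v‖ + ‖a‖ := norm_sub_le v a
  have hv' : K - U < ‖v‖ := by linarith
  rw [Set.indicator_of_mem (show v ∈ {w : V3 | K - U < ‖w‖} from hv')]
  have h3 : ‖v - a‖ ≤ 2 * ‖v‖ := by linarith [norm_nonneg a]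
  have h4 : ‖v - a‖ ^ 3 ≤ (2 * ‖v‖) ^ 3 := pow_le_pow_left₀ (norm_nonneg _) h3 3
  nlinarith [h4]

/-- **Pointwise: the heat-flux remainder of the quantitative cut-off is a velocity TAIL plus a tiny constant.** With
`w = v − u(x)`, `‖u‖ ≤ U`, `‖b‖ ≤ Bb`, `0 ≤ θ ≤ θM`, a remainder `≤ Cr` below `K²` and `≤ |s′ − 5θ| + Cr` above, `K ≥ max(1, 2U)`:
`|(b·w)(‖w‖² − 5θ − G(x,‖w‖²))| ≤ 8Bb(1 + 5θM + Cr)·‖v‖³1{‖v‖ > K − U} + Bb K Cr`. [folklore] -/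
theorem hi_pointwise {θs : T3 → ℝ} {us : T3 → V3} {Gs : T3 × ℝ → ℝ} {K U Bb θM Cr : ℝ}
    (hK1 : 1 ≤ K) (hKU : 2 * U ≤ K) (hBb : 0 ≤ Bb) (hθM0 : 0 ≤ θM) (hCr : 0 ≤ Cr)
    (hule : ∀ x, ‖us x‖ ≤ U)
    (hble : ∀ x, ‖(WithLp.toLp 2 fun k => Torus.partialDeriv k θs x / (2 * (θs x) ^ 2) : V3)‖ ≤ Bb)
    (hθle : ∀ x, θs x ≤ θM) (hθ0 : ∀ x, 0 ≤ θs x)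
    (hR1 : ∀ (x : T3) (s' : ℝ), 0 ≤ s' → s' ≤ K ^ 2 → |s' - 5 * θs x - Gs (x, s')| ≤ Cr)
    (hR2 : ∀ (x : T3) (s' : ℝ), K ^ 2 < s' → |s' - 5 * θs x - Gs (x, s')| ≤ |s' - 5 * θs x| + Cr) (x : T3) (v : V3) :
    |(∑ k : Fin 3, Torus.partialDeriv k θs x / (2 * (θs x) ^ 2) * (v - us x) k) *
        (‖v - us x‖ ^ 2 - 5 * θs x - Gs (x, ‖v - us x‖ ^ 2))| ≤
      8 * Bb * (1 + 5 * θM + Cr) * Set.indicator {w : V3 | K - U < ‖w‖} (fun w => ‖w‖ ^ 3) v + Bb * K * Cr := by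
  set w : V3 := v - us x with hw
  set c : V3 := WithLp.toLp 2 fun k => Torus.partialDeriv k θs x / (2 * (θs x) ^ 2) with hc
  have hin : inner ℝ c w = ∑ k : Fin 3, Torus.partialDeriv k θs x / (2 * (θs x) ^ 2) * w k := by
    simp [hc, PiLp.inner_apply, mul_comm]
  have hb : |∑ k : Fin 3, Torus.partialDeriv k θs x / (2 * (θs x) ^ 2) * w k| ≤ Bb * ‖w‖ := by
    rw [← hin]
    exact (abs_real_inner_le_norm _ _).trans (mul_le_mul_of_nonneg_right (hble x) (norm_nonneg _))
  have hI0 : 0 ≤ Set.indicator {w : V3 | K - U < ‖w‖} (fun w => ‖w‖ ^ 3) v :=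
    Set.indicator_nonneg (fun _ _ => by positivity) _
  have hw0 := norm_nonneg w
  have hK0 : 0 ≤ K := zero_le_one.trans hK1
  rw [abs_mul]
  by_cases hlow : ‖w‖ ^ 2 ≤ K ^ 2
  · have hwK : ‖w‖ ≤ K := (pow_le_pow_iff_left₀ hw0 hK0 two_ne_zero).1 hlow
    have h2 := hR1 x _ (sq_nonneg ‖w‖) hlow
    calc |∑ k : Fin 3, Torus.partialDeriv k θs x / (2 * (θs x) ^ 2) * w k| * |‖w‖ ^ 2 - 5 * θs x - Gs (x, ‖w‖ ^ 2)|
        ≤ Bb * ‖w‖ * Cr := mul_le_mul hb h2 (abs_nonneg _) (by positivity)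
      _ ≤ Bb * K * Cr := by gcongr
      _ ≤ _ := le_add_of_nonneg_left (by positivity)
  · have hKw : K < ‖w‖ := by
      by_contra h
      exact hlow (pow_le_pow_left₀ hw0 (not_lt.1 h) 2)
    have h1w : 1 ≤ ‖w‖ := hK1.trans hKw.le
    have h2 := hR2 x _ (not_le.1 hlow)
    have h3 : |‖w‖ ^ 2 - 5 * θs x| ≤ ‖w‖ ^ 2 + 5 * θM := by
      refine (abs_sub _ _).trans ?_
      rw [abs_of_nonneg (by positivity), abs_of_nonneg (by have := hθ0 x; positivity)]
      linarith [hθle x]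
    have hcube := cube_le_eight_indicator (hule x) hKU hKw
    calc |∑ k : Fin 3, Torus.partialDeriv k θs x / (2 * (θs x) ^ 2) * w k| * |‖w‖ ^ 2 - 5 * θs x - Gs (x, ‖w‖ ^ 2)|
        ≤ Bb * ‖w‖ * (‖w‖ ^ 2 + 5 * θM + Cr) := mul_le_mul hb (h2.trans (by linarith)) (abs_nonneg _) (by positivity)
      _ ≤ Bb * ((1 + 5 * θM + Cr) * ‖w‖ ^ 3) := by
          rw [mul_assoc]
          refine mul_le_mul_of_nonneg_left ?_ hBb
          have h13 : ‖w‖ ≤ ‖w‖ ^ 3 := by nlinarith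
          nlinarith [mul_nonneg hθM0 (sub_nonneg.2 h13), mul_nonneg hCr (sub_nonneg.2 h13)]
      _ ≤ Bb * ((1 + 5 * θM + Cr) * (8 * Set.indicator {w : V3 | K - U < ‖w‖} (fun w => ‖w‖ ^ 3) v)) := by
          gcongr
      _ ≤ _ := by nlinarith [mul_nonneg (mul_nonneg hBb hK0) hCr]

/-- **`tailRate_cubicTailWindow : CubicTailWindowRate`.** With the quantitative cut-off
(remainder `≤ Cr` below `K²`, `≤ |s′ − 5θ| + Cr` above) and per-time cubic tails `≤ eT` above `K − U` on `[s, s+w]`: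
`E_λ|∫_s^{s+w} Σ_i hi_s(Φ_r z_i) dr| ≤ w(N+1)(8Bb(1 + 5θM + Cr) eT + Bb K Cr)` (pathwise `hi_pointwise` on the good set, Tonelli
`cubicTailWindow`). [folklore] -/
theorem tailRate_cubicTailWindow : CubicTailWindowRate := by
  intro σ N Φ a₀ θ₀ u₀ θ u G K U Bb θM Cr eT s w hσ hσ2 ha hθ hu ha0 hθ0 hK1 hKU hBb hθM0 hCr heT hw hule hble hθle hθs0 hR1 hR2 hT
  haveI := isProbabilityMeasure_localGibbsLaw ha hθ hu ha0 hθ0 hσ2.le N Φ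
  have hN1 : (0 : ℝ) < (N : ℝ) + 1 := by positivity
  set CT : ℝ := 8 * Bb * (1 + 5 * θM + Cr) with hCT
  have hCT0 : 0 ≤ CT := by positivity
  set c₀ : ℝ := Bb * K * Cr with hc₀
  have hc₀0 : 0 ≤ c₀ := by rw [hc₀]; exact mul_nonneg (mul_nonneg hBb (zero_le_one.trans hK1)) hCr
  have hsw : s ≤ s + w := le_add_of_nonneg_right hw
  -- pointwise in time, summed over the particles
  have hpt : ∀ (r : ℝ) (z : Config (N + 1) (Fin 3) T3),
      ‖∑ i : Fin (N + 1),
        ((∑ k : Fin 3, Torus.partialDeriv k (θ s) (Φ.flow r z i).1 / (2 * (θ s (Φ.flow r z i).1) ^ (2 : ℕ)) *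
            ((Φ.flow r z i).2 - u s (Φ.flow r z i).1) k) *
          (‖(Φ.flow r z i).2 - u s (Φ.flow r z i).1‖ ^ (2 : ℕ) - 5 * θ s (Φ.flow r z i).1 -
            G s ((Φ.flow r z i).1, ‖(Φ.flow r z i).2 - u s (Φ.flow r z i).1‖ ^ (2 : ℕ))))‖ ≤
        CT * tailSum N (K - U) (Φ.flow r z) + ((N : ℝ) + 1) * c₀ := by
    intro r z
    rw [Real.norm_eq_abs]
    refine (Finset.abs_sum_le_sum_abs _ _).trans ?_
    calc _ ≤ ∑ i : Fin (N + 1), (CT * Set.indicator {w : V3 | K - U < ‖w‖} (fun w => ‖w‖ ^ 3) ((Φ.flow r z i).2) + c₀) :=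
          Finset.sum_le_sum fun i _ => hi_pointwise hK1 hKU hBb hθM0 hCr hule hble hθle hθs0 hR1 hR2 _ _
      _ = CT * tailSum N (K - U) (Φ.flow r z) + ((N : ℝ) + 1) * c₀ := by
          rw [Finset.sum_add_distrib, ← Finset.mul_sum, Finset.sum_const, Finset.card_univ, Fintype.card_fin,
            nsmul_eq_mul]
          push_cast
          rfl
  -- pathwise on the good set: the window integral
  have hpath : ∀ z ∈ Φ.good,
      |∫ r in s..(s + w), ∑ i : Fin (N + 1),
        ((∑ k : Fin 3, Torus.partialDeriv k (θ s) (Φ.flow r z i).1 / (2 * (θ s (Φ.flow r z i).1) ^ (2 : ℕ)) *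
            ((Φ.flow r z i).2 - u s (Φ.flow r z i).1) k) *
          (‖(Φ.flow r z i).2 - u s (Φ.flow r z i).1‖ ^ (2 : ℕ) - 5 * θ s (Φ.flow r z i).1 -
            G s ((Φ.flow r z i).1, ‖(Φ.flow r z i).2 - u s (Φ.flow r z i).1‖ ^ (2 : ℕ))))| ≤
        CT * (∫ r in s..(s + w), tailSum N (K - U) (Φ.flow r z)) + w * (((N : ℝ) + 1) * c₀) := by
    intro z hz
    have hTi : IntervalIntegrable (fun r => tailSum N (K - U) (Φ.flow r z)) volume s (s + w) :=
      (intervalIntegrable_iff_integrableOn_Ioc_of_le hsw).2 (integrableOn_tailSum Φ (K - U) hz s (s + w))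
    have hgi : IntervalIntegrable (fun r => CT * tailSum N (K - U) (Φ.flow r z) + ((N : ℝ) + 1) * c₀) volume s (s + w) :=
      (hTi.const_mul CT).add intervalIntegrable_const
    have h := intervalIntegral.norm_integral_le_of_norm_le hsw (ae_of_all _ fun r _ => hpt r z) hgi
    rw [Real.norm_eq_abs] at h
    refine h.trans (le_of_eq ?_)
    rw [intervalIntegral.integral_add (hTi.const_mul CT) intervalIntegrable_const, intervalIntegral.integral_const_mul,
      intervalIntegral.integral_const, smul_eq_mul, add_sub_cancel_left]
  have hY0 : ∀ z : Config (N + 1) (Fin 3) T3, 0 ≤ ∫ r in s..(s + w), tailSum N (K - U) (Φ.flow r z) := fun z =>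
    intervalIntegral.integral_nonneg hsw fun r _ => (tailSum_nonneg_le N (K - U) _).1
  -- Tonelli for the tail sum
  have hW := cubicTailWindow σ N Φ a₀ θ₀ u₀ (K - U) eT s w hσ hσ2 ha hθ hu ha0 hθ0 heT hw hT
  calc _ ≤ ∫⁻ z, (ENNReal.ofReal CT * ENNReal.ofReal (∫ r in s..(s + w), tailSum N (K - U) (Φ.flow r z)) +
        ENNReal.ofReal (w * (((N : ℝ) + 1) * c₀))) ∂(localGibbsLaw σ a₀ u₀ θ₀ N Φ) := by
        refine lintegral_mono_ae ?_
        filter_upwards [ae_mem_good_localGibbsLaw σ a₀ θ₀ u₀ N Φ] with z hz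
        calc _ ≤ ENNReal.ofReal (CT * (∫ r in s..(s + w), tailSum N (K - U) (Φ.flow r z)) + w * (((N : ℝ) + 1) * c₀)) :=
              ENNReal.ofReal_le_ofReal (hpath z hz)
          _ ≤ ENNReal.ofReal (CT * (∫ r in s..(s + w), tailSum N (K - U) (Φ.flow r z))) +
              ENNReal.ofReal (w * (((N : ℝ) + 1) * c₀)) := ENNReal.ofReal_add_le
          _ = _ := by rw [ENNReal.ofReal_mul hCT0]
    _ = ENNReal.ofReal CT * ∫⁻ z, ENNReal.ofReal (∫ r in s..(s + w), tailSum N (K - U) (Φ.flow r z))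
          ∂(localGibbsLaw σ a₀ u₀ θ₀ N Φ) + ENNReal.ofReal (w * (((N : ℝ) + 1) * c₀)) := by
        rw [lintegral_add_right _ measurable_const, lintegral_const_mul' _ _ ENNReal.ofReal_ne_top, lintegral_const,
          measure_univ, mul_one]
    _ ≤ ENNReal.ofReal CT * ENNReal.ofReal (w * ((N : ℝ) + 1) * eT) + ENNReal.ofReal (w * (((N : ℝ) + 1) * c₀)) := by
        gcongr
        exact hW
    _ = ENNReal.ofReal (w * ((N : ℝ) + 1) * (8 * Bb * (1 + 5 * θM + Cr) * eT + Bb * K * Cr)) := by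
        rw [← ENNReal.ofReal_mul hCT0, ← ENNReal.ofReal_add (by positivity) (by positivity)]
        congr 1
        rw [hCT, hc₀]; ring

/-! ## §3 The rate bookkeeping (pure real arithmetic) -/

/-- `1/min(a, b) ≤ 1/a + 1/b` for `a, b > 0`, in the form used for the tilt `β = min(κ/(Cg K₁), β₀C)`:
`10t/β ≤ 10t Cg K₁/κ + 10t/β₀C`. [folklore] -/
theorem ten_div_tilt_le {κ Cg K₁ β₀C β t : ℝ} (hκ : 0 < κ) (hCg : 0 < Cg) (hK₁ : 0 < K₁) (hβ₀C : 0 < β₀C) (ht : 0 ≤ t)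
    (hβ : β = min (κ / (Cg * K₁)) β₀C) : 2 * (5 / β) * t ≤ 10 * t * Cg * K₁ / κ + 10 * t / β₀C := by
  have ha : 0 < κ / (Cg * K₁) := by positivity
  have h1 : 0 ≤ 10 * t * Cg * K₁ / κ := by positivity
  have h2 : 0 ≤ 10 * t / β₀C := by positivity
  rcases min_choice (κ / (Cg * K₁)) β₀C with h | h <;> rw [h] at hβ <;> rw [hβ]
  · have e : 2 * (5 / (κ / (Cg * K₁))) * t = 10 * t * Cg * K₁ / κ := by field_simp; ring
    linarith
  · have e : 2 * (5 / β₀C) * t = 10 * t / β₀C := by ring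
    linarith

/-- **The floor budget.** With the tail rate `c′ = 10tCg/κ + 2` and the tilt `β = min(κ/(Cg K₁), β₀C)`, the per-window floor
`S = C_T e^{-c′(K₁−U)} + Bb K₁ Cρ e^{-c′K₁}` satisfies `S e^{10t/β} ≤ (C_T e^{c′U} + Bb Cρ) e^{10t/β₀C} e^{-K₁}`. [folklore] -/
theorem floor_budget {CT Bb Cρ U K₁ t κ Cg β β₀C : ℝ} (hCT : 0 ≤ CT) (hBb : 0 ≤ Bb) (hCρ : 0 ≤ Cρ) (hK₁ : 1 ≤ K₁)
    (ht : 0 ≤ t) (hκ : 0 < κ) (hCg : 0 < Cg) (hβ₀C : 0 < β₀C) (hβ : β = min (κ / (Cg * K₁)) β₀C) :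
    (CT * Real.exp (-((10 * t * Cg / κ + 2) * (K₁ - U))) + Bb * K₁ * (Cρ * Real.exp (-((10 * t * Cg / κ + 2) * K₁)))) *
        Real.exp (2 * (5 / β) * t) ≤
      (CT * Real.exp ((10 * t * Cg / κ + 2) * U) + Bb * Cρ) * Real.exp (10 * t / β₀C) * Real.exp (-K₁) := by
  set c' : ℝ := 10 * t * Cg / κ + 2 with hc'
  have hK₁0 : 0 < K₁ := zero_lt_one.trans_le hK₁
  have hE : Real.exp (2 * (5 / β) * t) ≤ Real.exp (10 * t * Cg * K₁ / κ) * Real.exp (10 * t / β₀C) := by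
    rw [← Real.exp_add]
    exact Real.exp_le_exp.2 (ten_div_tilt_le hκ hCg hK₁0 hβ₀C ht hβ)
  have hE0 : 0 ≤ Real.exp (2 * (5 / β) * t) := (Real.exp_pos _).le
  have hx1 : Real.exp (-(c' * (K₁ - U))) * Real.exp (2 * (5 / β) * t) ≤
      Real.exp (c' * U) * Real.exp (10 * t / β₀C) * Real.exp (-K₁) := by
    calc _ ≤ Real.exp (-(c' * (K₁ - U))) * (Real.exp (10 * t * Cg * K₁ / κ) * Real.exp (10 * t / β₀C)) :=
          mul_le_mul_of_nonneg_left hE (Real.exp_pos _).le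
      _ = Real.exp (c' * U) * Real.exp (10 * t / β₀C) * Real.exp (-(2 * K₁)) := by
          rw [← Real.exp_add, ← Real.exp_add, ← Real.exp_add, ← Real.exp_add]
          congr 1
          rw [hc']; ring
      _ ≤ Real.exp (c' * U) * Real.exp (10 * t / β₀C) * Real.exp (-K₁) := by gcongr; linarith
  have hx2 : K₁ * Real.exp (-(c' * K₁)) * Real.exp (2 * (5 / β) * t) ≤ Real.exp (10 * t / β₀C) * Real.exp (-K₁) := by
    have hKe : K₁ * Real.exp (-(2 * K₁)) ≤ Real.exp (-K₁) := by
      have h1 : K₁ ≤ Real.exp K₁ := by linarith [Real.add_one_le_exp K₁]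
      calc K₁ * Real.exp (-(2 * K₁)) ≤ Real.exp K₁ * Real.exp (-(2 * K₁)) :=
            mul_le_mul_of_nonneg_right h1 (Real.exp_pos _).le
        _ = Real.exp (-K₁) := by rw [← Real.exp_add]; ring_nf
    calc _ ≤ K₁ * Real.exp (-(c' * K₁)) * (Real.exp (10 * t * Cg * K₁ / κ) * Real.exp (10 * t / β₀C)) :=
          mul_le_mul_of_nonneg_left hE (by positivity)
      _ = K₁ * Real.exp (-(2 * K₁)) * Real.exp (10 * t / β₀C) := by
          have e : Real.exp (-(c' * K₁)) * Real.exp (10 * t * Cg * K₁ / κ) = Real.exp (-(2 * K₁)) := by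
            rw [← Real.exp_add]; congr 1; rw [hc']; ring
          calc _ = K₁ * (Real.exp (-(c' * K₁)) * Real.exp (10 * t * Cg * K₁ / κ)) * Real.exp (10 * t / β₀C) := by ring
            _ = _ := by rw [e]
      _ ≤ Real.exp (-K₁) * Real.exp (10 * t / β₀C) := mul_le_mul_of_nonneg_right hKe (Real.exp_pos _).le
      _ = _ := mul_comm _ _
  have p1 := mul_le_mul_of_nonneg_left hx1 hCT
  have p2 := mul_le_mul_of_nonneg_left hx2 (mul_nonneg hBb hCρ)
  calc _ = CT * (Real.exp (-(c' * (K₁ - U))) * Real.exp (2 * (5 / β) * t)) +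
        Bb * Cρ * (K₁ * Real.exp (-(c' * K₁)) * Real.exp (2 * (5 / β) * t)) := by ring
    _ ≤ CT * (Real.exp (c' * U) * Real.exp (10 * t / β₀C) * Real.exp (-K₁)) +
        Bb * Cρ * (Real.exp (10 * t / β₀C) * Real.exp (-K₁)) := add_le_add p1 p2
    _ = _ := by ring

/-- **The rate budget** (tail-rate version of `ClampedTransferDockRate.rate_budget`): with `ε := δ e^{-2Kt}/(8(1+t)) + S`, a floor
`S e^{2Kt} ≤ A′ e^{-K₁}` and a level with `4(1+t) A′ e^{-K₁} ≤ δ/2`: `4(1+t) ε e^{2Kt} ≤ δ`. [folklore] -/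
theorem rate_budget' {S A' K K₁ t δ : ℝ} (ht : 0 < t) (hS : S * Real.exp (2 * K * t) ≤ A' * Real.exp (-K₁))
    (h : 4 * (1 + t) * A' * Real.exp (-K₁) ≤ δ / 2) :
    4 * (1 + t) * (δ * Real.exp (-(2 * K * t)) / (8 * (1 + t)) + S) * Real.exp (2 * K * t) ≤ δ := by
  -- adapted from `ClampedTransferDockRate.rate_budget`
  have hE : Real.exp (-(2 * K * t)) * Real.exp (2 * K * t) = 1 := by
    rw [← Real.exp_add, neg_add_cancel, Real.exp_zero]
  have h1 : 4 * (1 + t) * (δ * Real.exp (-(2 * K * t)) / (8 * (1 + t))) * Real.exp (2 * K * t) = δ / 2 := by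
    calc _ = 4 * (1 + t) * δ / (8 * (1 + t)) * (Real.exp (-(2 * K * t)) * Real.exp (2 * K * t)) := by ring
      _ = δ / 2 := by rw [hE, mul_one, div_eq_iff (by positivity)]; ring
  have h2 : 4 * (1 + t) * S * Real.exp (2 * K * t) ≤ δ / 2 := by
    have := mul_le_mul_of_nonneg_left hS (by positivity : (0 : ℝ) ≤ 4 * (1 + t))
    nlinarith
  calc _ = 4 * (1 + t) * (δ * Real.exp (-(2 * K * t)) / (8 * (1 + t))) * Real.exp (2 * K * t) +
        4 * (1 + t) * S * Real.exp (2 * K * t) := by ring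
    _ ≤ δ := by rw [h1]; linarith

/-- **One ledger step** (S7a bookkeeping, no band; cf. `ClampedTransferDockRate.ledger_step`). [folklore] -/
theorem ledger_step' {H1 H0 X L sup w Nr ε' ε₀ S β Cst Q : ℝ} (hbal : H1 - H0 = X + L)
    (hWE : X ≤ 5 / β * w * H0 + w * Nr * ε' + Q + w * Nr * Cst) (hQ : Q = w * Nr * S)
    (hH : H0 ≤ sup) (hK : 0 ≤ 5 / β * w) (hwN : 0 ≤ w * Nr) (hε : ε' ≤ ε₀) :
    H1 ≤ H0 + 5 / β * w * sup + w * Nr * (ε₀ + S) + (L + w * Nr * Cst) := by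
  have h1 := mul_le_mul_of_nonneg_left hH hK
  have h2 := mul_le_mul_of_nonneg_left hε hwN
  linarith

end Summit.AtomisticToContinuum.HydrodynamicLimit.Theorems.TransferEntropyClockTailRateCubic

end
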